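import Literature.Probability.RandomPlanarGeometry.SAWScalingLimitFamily
import HarnessLib

/-!
# Joint subsequential scaling limits of the critical planar SAW

Topic `Literature/Probability/RandomPlanarGeometry` (definition item
`defn-SAW.IsSubseqScalingLimitFamily`, for route SAWZoomRigidity, where the clause is inlined
five times in `SubseqLimitAxioms`, `JointCompactness`, `ZoomInvariantLimitSet`). Sibling of
`SAW.IsScalingLimitFamily` (`SAWScalingLimitFamily.lean`, the full-filter version along
`δ → 0⁺`).

Lawler–Schramm–Werner (2004, §1 and §3.4.2) stress that the existence of the scaling limit of
the planar SAW is open; what precompactness arguments give are limits ALONG SEQUENCES of meshes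
`δₙ → 0⁺` (and subsequences thereof), jointly for all domains by a diagonal argument — the
objects `Ω_SAW` of route SAWZoomRigidity. This file names that predicate and proves its
elementary API.

## Contents (namespace `Literature.Probability.RandomPlanarGeometry.SAW`)

* `SAW.IsSubseqScalingLimitFamily P δ` — along the sequence of meshes `δ : ℕ → ℝ` (positive,
  tending to `0`), for EVERY Dobrushin domain `D` and EVERY endpoint approximation `a_δ, b_δ`
  (`IsEndpointApprox`, full filter), the critical SAW laws pushed to curves converge weakly
  (bounded continuous test functions) to `P D` along `n → ∞`. Literally the clause inlined in the
  route (`isSubseqScalingLimitFamily_iff` is `Iff.rfl`).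
* `SAW.subseqLimitSet = {P | P.IsChordal ∧ ∃ δ, IsSubseqScalingLimitFamily P δ}` — the set
  `Ω_SAW` of joint subsequential limits (`mem_subseqLimitSet_iff` is `Iff.rfl`).
* Proved API: restriction of a full limit to any positive null sequence
  (`IsScalingLimitFamily.isSubseqScalingLimitFamily`) and the converse sequential
  characterisation (`isScalingLimitFamily_iff_forall_isSubseqScalingLimitFamily`: `𝓝[>] 0` is
  countably generated); stability under subsequences (`IsSubseqScalingLimitFamily.comp_strictMono`);
  uniqueness of the limit along a GIVEN sequence (`IsSubseqScalingLimitFamily.apply_eq`,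
  `….eq_of_isChordal`: Billingsley Thm 1.2 via `ext_of_forall_integral_eq_of_IsFiniteMeasure`,
  an endpoint approximation existing by `exists_isEndpointApprox`); the pushforward form of the
  convergence clause (`IsSubseqScalingLimitFamily.tendsto_integral_map`).

## Design notes

Positivity `∀ n, 0 < δ n` (not merely eventually) is what the route writes; the sequential
characterisation repairs a sequence tending to `0` within `(0, ∞)` on finitely many indices.
No measurability/probability clause is built in (as for `TendstoLaw`); `IsChordal` lives in
`subseqLimitSet`, as in the route. Mathlib's `TendstoInDistribution` along `atTop` would need
`IsProbabilityMeasure (law …)` at EVERY index, which fails at the junk indices where `a_δ, b_δ`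
are not joined (`law = 0`), so the equivalence is not stated (cf.
`tendstoLaw_iff_tendstoInDistribution`, `CurveSpace.lean`, for the full filter).

## References

* G. F. Lawler, O. Schramm, W. Werner, *On the scaling limit of planar self-avoiding walk*,
  Proc. Sympos. Pure Math. 72 (2004), arXiv:math/0204277: §3.4.1–§3.4.2 (weak convergence of
  measures on curves; the boundary-to-boundary limit `m_SAW(z, w; D)`), §1 (existence open).
* S. Smirnov, *Towards conformal invariance of 2D lattice models*, ICM 2006 (2007), §2–3
  (precompactness and identification of subsequential limits as the general scheme).
* P. Billingsley, *Convergence of probability measures*, 2nd ed. (1999), Thm 1.2.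

Mathlib: `Filter.tendsto_iff_seq_tendsto`, `tendsto_nhdsWithin_iff`,
`StrictMono.tendsto_atTop`, `tendsto_nhds_unique`, `ext_of_forall_integral_eq_of_IsFiniteMeasure`,
`MeasureTheory.integral_map`. Tree: `SAW.IsScalingLimitFamily`, `SAW.exists_isEndpointApprox`,
`SAW.aemeasurable_curve`, `TendstoLaw`.
-/

noncomputable section

open MeasureTheory Filter Topology Set
open Literature.Probability.LatticeModels
open scoped NNReal ENNReal BoundedContinuousFunction

namespace Literature.Probability.RandomPlanarGeometry

namespace SAW

/-! ### The definitions -/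

/-- **`P` is a joint subsequential scaling limit of the critical square-lattice SAW along the
mesh sequence `δ`**: the meshes `δ n` are positive and tend to `0`, and for every Dobrushin domain
`D = (Ω; a, b)` and every endpoint approximation `a_δ, b_δ` (`IsEndpointApprox`), the critical
SAW laws `P_{δₙ} ∝ μ^{-|γ|}` on SAWs of `Ω_{δₙ}` from `a_{δₙ}` to `b_{δₙ}` (`law`), pushed to curves
modulo reparametrisation (`DomainSAW.curve`), converge weakly to `P D` as `n → ∞`: for every
bounded continuous `f`, `∫ f(γ.curve) dP_{δₙ} → ∫ f d(P D)`. The full-filter version is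
`IsScalingLimitFamily`; Lawler–Schramm–Werner (§1, §3.4.2) note that only such (sub)sequential
limits are available as long as the existence of the scaling limit is open. Literally the clause
inlined in route SAWZoomRigidity. [cite: LawlerSchrammWerner2004SAW, §3.4.1–§3.4.2] -/
def IsSubseqScalingLimitFamily (P : ChordalFamily) (δ : ℕ → ℝ) : Prop :=
  (∀ n, 0 < δ n) ∧ Filter.Tendsto δ Filter.atTop (nhds 0) ∧
    ∀ (D : DobrushinDomain) (a b : ℝ → Site 2), IsEndpointApprox D a b →
      ∀ f : BoundedContinuousFunction (CurveClass ℂ) ℝ,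
        Filter.Tendsto (fun n => ∫ γ, f γ.curve ∂(law D.carrier (δ n) (a (δ n)) (b (δ n))))
          Filter.atTop (nhds (∫ γ, f γ ∂(P D)))

/-- **The set `Ω_SAW` of joint subsequential scaling limits** of the critical planar SAW: the
chordal curve families that are subsequential scaling limits along SOME sequence of meshes
(route SAWZoomRigidity). [cite: LawlerSchrammWerner2004SAW, §3.4.2] -/
def subseqLimitSet : Set ChordalFamily :=
  {P | P.IsChordal ∧ ∃ δ : ℕ → ℝ, IsSubseqScalingLimitFamily P δ}

variable {P P' : ChordalFamily} {δ : ℕ → ℝ}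

/-- Unfolding `IsSubseqScalingLimitFamily` (the form inlined in the route files). [folklore] -/
theorem isSubseqScalingLimitFamily_iff :
    IsSubseqScalingLimitFamily P δ ↔
      (∀ n, 0 < δ n) ∧ Filter.Tendsto δ Filter.atTop (nhds 0) ∧
        ∀ (D : DobrushinDomain) (a b : ℝ → Site 2), IsEndpointApprox D a b →
          ∀ f : BoundedContinuousFunction (CurveClass ℂ) ℝ,
            Filter.Tendsto (fun n => ∫ γ, f γ.curve ∂(law D.carrier (δ n) (a (δ n)) (b (δ n))))
              Filter.atTop (nhds (∫ γ, f γ ∂(P D))) :=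
  Iff.rfl

/-- Unfolding `subseqLimitSet` (the form inlined in the route files). [folklore] -/
theorem mem_subseqLimitSet_iff :
    P ∈ subseqLimitSet ↔ P.IsChordal ∧ ∃ δ : ℕ → ℝ, IsSubseqScalingLimitFamily P δ :=
  Iff.rfl

/-- The meshes of a subsequential limit are positive. [folklore] -/
theorem IsSubseqScalingLimitFamily.pos (h : IsSubseqScalingLimitFamily P δ) (n : ℕ) : 0 < δ n :=
  h.1 n

/-- The meshes of a subsequential limit tend to `0`. [folklore] -/
theorem IsSubseqScalingLimitFamily.tendsto_zero (h : IsSubseqScalingLimitFamily P δ) :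
    Tendsto δ atTop (𝓝 0) :=
  h.2.1

/-- The meshes of a subsequential limit tend to `0` within `(0, ∞)`. [folklore] -/
theorem IsSubseqScalingLimitFamily.tendsto_nhdsWithin (h : IsSubseqScalingLimitFamily P δ) :
    Tendsto δ atTop (𝓝[>] (0 : ℝ)) :=
  tendsto_nhdsWithin_iff.2 ⟨h.tendsto_zero, Eventually.of_forall h.pos⟩

/-- The convergence clause of a subsequential limit. [cite: LawlerSchrammWerner2004SAW, §3.4.2] -/
theorem IsSubseqScalingLimitFamily.tendsto_integral (h : IsSubseqScalingLimitFamily P δ)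
    {D : DobrushinDomain} {a b : ℝ → Site 2} (hab : IsEndpointApprox D a b) (f : CurveClass ℂ →ᵇ ℝ) :
    Tendsto (fun n => ∫ γ, f γ.curve ∂(law D.carrier (δ n) (a (δ n)) (b (δ n)))) atTop
      (𝓝 (∫ γ, f γ ∂(P D))) :=
  h.2.2 D a b hab f

/-- The convergence clause in pushforward form: the image laws `(P_{δₙ}).map curve` converge
weakly to `P D` on bounded continuous functions (`integral_map`, the SAW observable being
measurable for the discrete σ-algebra). [folklore] -/
theorem IsSubseqScalingLimitFamily.tendsto_integral_map (h : IsSubseqScalingLimitFamily P δ)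
    {D : DobrushinDomain} {a b : ℝ → Site 2} (hab : IsEndpointApprox D a b) (f : CurveClass ℂ →ᵇ ℝ) :
    Tendsto (fun n => ∫ γ, f γ ∂((law D.carrier (δ n) (a (δ n)) (b (δ n))).map DomainSAW.curve))
      atTop (𝓝 (∫ γ, f γ ∂(P D))) := by
  refine (h.tendsto_integral hab f).congr fun n => ?_
  exact (integral_map (aemeasurable_curve _ _ _ _) f.continuous.aestronglyMeasurable).symm

/-- Members of `Ω_SAW` are chordal. [folklore] -/
theorem isChordal_of_mem_subseqLimitSet (h : P ∈ subseqLimitSet) : P.IsChordal := h.1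

/-! ### Full limit versus limits along sequences -/

/-- **A full scaling limit is a subsequential limit along every positive null sequence of
meshes** (compose `TendstoLaw` along `𝓝[>] 0` with `δₙ → 0⁺`). [folklore] -/
theorem IsScalingLimitFamily.isSubseqScalingLimitFamily (hP : IsScalingLimitFamily P)
    (hpos : ∀ n, 0 < δ n) (hδ : Tendsto δ atTop (𝓝 0)) : IsSubseqScalingLimitFamily P δ := by
  refine ⟨hpos, hδ, fun D a b hab f => ?_⟩
  have hδ' : Tendsto δ atTop (𝓝[>] (0 : ℝ)) :=
    tendsto_nhdsWithin_iff.2 ⟨hδ, Eventually.of_forall hpos⟩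
  exact (hP.tendstoLaw hab f).comp hδ'

/-- A full scaling limit lies in `Ω_SAW` (along `δₙ = 1/(n+1)`). [folklore] -/
theorem IsScalingLimitFamily.mem_subseqLimitSet (hP : IsScalingLimitFamily P) : P ∈ subseqLimitSet :=
  ⟨hP.isChordal, fun n => 1 / ((n : ℝ) + 1),
    hP.isSubseqScalingLimitFamily (fun n => by positivity) tendsto_one_div_add_atTop_nhds_zero_nat⟩

/-- **Sequential characterisation of the full scaling limit**: `P` is the scaling limit iff it is
chordal and a subsequential limit along EVERY positive null sequence of meshes (`𝓝[>] 0` is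
countably generated: `Filter.tendsto_iff_seq_tendsto`, after repairing a sequence tending to `0`
within `(0, ∞)` on its finitely many non-positive terms). [folklore] -/
theorem isScalingLimitFamily_iff_forall_isSubseqScalingLimitFamily :
    IsScalingLimitFamily P ↔ P.IsChordal ∧
      ∀ δ : ℕ → ℝ, (∀ n, 0 < δ n) → Tendsto δ atTop (𝓝 0) → IsSubseqScalingLimitFamily P δ := by
  refine ⟨fun hP => ⟨hP.isChordal, fun δ hpos hδ => hP.isSubseqScalingLimitFamily hpos hδ⟩,
    fun ⟨hc, h⟩ => ⟨hc, fun D a b hab f => ?_⟩⟩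
  refine tendsto_iff_seq_tendsto.2 fun x hx => ?_
  obtain ⟨hx0, hxpos⟩ := tendsto_nhdsWithin_iff.1 hx
  classical
  -- repair the finitely many non-positive terms
  set x' : ℕ → ℝ := fun n => if 0 < x n then x n else 1 with hx'
  have hxx' : x' =ᶠ[atTop] x := by
    filter_upwards [hxpos] with n hn
    simp [hx', mem_Ioi.1 hn]
  have hpos' : ∀ n, 0 < x' n := fun n => by
    simp only [hx']
    split_ifs with hn
    · exact hn
    · exact one_pos
  set g : ℝ → ℝ := fun t => ∫ γ, f γ.curve ∂(law D.carrier t (a t) (b t)) with hg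
  have h' : Tendsto (g ∘ x') atTop (𝓝 (∫ γ, f γ ∂(P D))) :=
    (h x' hpos' (hx0.congr' hxx'.symm)).tendsto_integral hab f
  exact h'.congr' (hxx'.fun_comp g)

/-! ### Subsequences -/

/-- **Stability under subsequences**: a subsequential limit along `δ` is one along `δ ∘ φ` for
every strictly increasing `φ`. [folklore] -/
theorem IsSubseqScalingLimitFamily.comp_strictMono (h : IsSubseqScalingLimitFamily P δ) {φ : ℕ → ℕ}
    (hφ : StrictMono φ) : IsSubseqScalingLimitFamily P (δ ∘ φ) :=
  ⟨fun n => h.pos (φ n), h.tendsto_zero.comp hφ.tendsto_atTop,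
    fun _ _ _ hab f => (h.tendsto_integral hab f).comp hφ.tendsto_atTop⟩

/-! ### Uniqueness along a given sequence -/

/-- **Limits along the same sequence coincide**: if `P` and `P'` are subsequential limits along
the SAME mesh sequence and `P D`, `P' D` are finite measures, then `P D = P' D` — both are limits
of the integrals of the same SAW laws (an endpoint approximation exists,
`exists_isEndpointApprox`), and a finite Borel measure on the metric space `CurveClass ℂ` is
determined by the integrals of bounded continuous functions (Billingsley Thm 1.2,
`ext_of_forall_integral_eq_of_IsFiniteMeasure`). Along DIFFERENT sequences nothing of the sort
holds: that non-uniqueness is the subject of route SAWZoomRigidity. [folklore] -/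
theorem IsSubseqScalingLimitFamily.apply_eq (h : IsSubseqScalingLimitFamily P δ)
    (h' : IsSubseqScalingLimitFamily P' δ) (D : DobrushinDomain) [IsFiniteMeasure (P D)]
    [IsFiniteMeasure (P' D)] : P D = P' D := by
  obtain ⟨a, b, hab⟩ := exists_isEndpointApprox D
  exact ext_of_forall_integral_eq_of_IsFiniteMeasure fun f =>
    tendsto_nhds_unique (h.tendsto_integral hab f) (h'.tendsto_integral hab f)

/-- **Two chordal subsequential limits along the same sequence are equal.** [folklore] -/
theorem IsSubseqScalingLimitFamily.eq_of_isChordal (h : IsSubseqScalingLimitFamily P δ)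
    (h' : IsSubseqScalingLimitFamily P' δ) (hc : P.IsChordal) (hc' : P'.IsChordal) : P = P' := by
  funext D
  haveI : IsProbabilityMeasure (P D) := (hc D).1
  haveI : IsProbabilityMeasure (P' D) := (hc' D).1
  exact h.apply_eq h' D

/-- A full scaling limit is the only chordal subsequential limit (along any sequence). [folklore] -/
theorem IsScalingLimitFamily.eq_of_isSubseqScalingLimitFamily (hP : IsScalingLimitFamily P)
    (h' : IsSubseqScalingLimitFamily P' δ) (hc' : P'.IsChordal) : P = P' :=
  (hP.isSubseqScalingLimitFamily h'.pos h'.tendsto_zero).eq_of_isChordal h' hP.isChordal hc'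

/-- If the full scaling limit `P` exists, `Ω_SAW = {P}`. [folklore] -/
theorem IsScalingLimitFamily.subseqLimitSet_eq (hP : IsScalingLimitFamily P) : subseqLimitSet = {P} := by
  refine Set.eq_singleton_iff_unique_mem.2 ⟨hP.mem_subseqLimitSet, fun P' hP' => ?_⟩
  obtain ⟨hc', δ', h'⟩ := hP'
  exact (hP.eq_of_isSubseqScalingLimitFamily h' hc').symm

end SAW

end Literature.Probability.RandomPlanarGeometry
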